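import Mathlib
import Summits.Ventures.HodgeRepro.Tier4.Line3.IntegralScalarExcess

/-!
# Tier4/Line4/SlabCount — algebraic integers with one archimedean coordinate in a disc and the others bounded: linearly many

Blind re-derivation cell `pub-hodge-repro`, Tier 4 «PROVE THE STEP», LINE L4 (C-L4-TAIL, the count (S2′)(i) of STATUS
S14958 / S14963 / S14968 (R-21)), seat t4-L3-p2 (g3). Pure number theory, Mathlib + x2's `one_le_abs_norm`.

For a number field `k`, an infinite place `w₀` and a bound `B`, the algebraic integers `x` with `(w₀ x)² ≤ R` and `w x ≤ B` at
every other place number at most `C′ (1 + R)`, with `C′` depending on `k, w₀, B` only — the count «`≍ e^T` orbits below size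
`d = log (1 + |t|_{w₀}) ≤ T`» behind the layer-cake of TailAssembly. No measure theory: two lattice points of the slab are
SEPARATED at `w₀` (the product formula `∏_w (w z)^{mult w} = |N z| ≥ 1` on their difference `z ≠ 0`, whose other coordinates
are `≤ 2B`: `ρ ≤ w₀ z`, `exists_sep`), so their `w₀`-coordinates occupy distinct cells of a square grid of mesh `ρ/2` inside the
disc of radius `√R` — at most `(2 √R/(ρ/2) + 5)² ≤ C′ (1 + R)` cells (`card_le_of_separated`).

Nothing here says anything about the status of the Hodge conjecture for CM abelian varieties, which is NOT proved
(HC_CM is NOT proved by anyone in this repository).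
-/

set_option autoImplicit false

noncomputable section

namespace Summit.Ventures.HodgeRepro.Tier4.Line4

open NumberField NumberField.InfinitePlace
open scoped NumberField Classical

/-! ## A. Separated points of a disc: a grid count -/

/-- Two reals with the same floor at mesh `s` differ by less than `s`. -/
theorem abs_sub_lt_of_floor_eq {s : ℝ} (hs : 0 < s) {x y : ℝ} (h : ⌊x / s⌋ = ⌊y / s⌋) : |x - y| < s := by
  have h1 := Int.floor_le (x / s)
  have h2 := Int.lt_floor_add_one (x / s)
  have h3 := Int.floor_le (y / s)
  have h4 := Int.lt_floor_add_one (y / s)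
  rw [h] at h1 h2
  have h5 : |x / s - y / s| < 1 := by
    rw [abs_lt]
    constructor <;> linarith
  rw [← sub_div, abs_div, abs_of_pos hs, div_lt_one hs] at h5
  exact h5

/-- **A GRID COUNT**: a finite set of complex numbers of modulus `≤ r`, pairwise at distance `≥ 2 s`, has at most
`(2 (r / s) + 5)²` elements (distinct cells of the grid of mesh `s`). -/
theorem card_le_of_separated {s : ℝ} (hs : 0 < s) {r : ℝ} (hr : 0 ≤ r) (t : Finset ℂ)
    (hsep : ∀ z ∈ t, ∀ z' ∈ t, z ≠ z' → 2 * s ≤ ‖z - z'‖) (hbd : ∀ z ∈ t, ‖z‖ ≤ r) :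
    (t.card : ℝ) ≤ (2 * (r / s) + 5) ^ 2 := by
  set K : ℤ := ⌈r / s⌉ + 1 with hK
  let f : ℂ → ℤ × ℤ := fun z => (⌊z.re / s⌋, ⌊z.im / s⌋)
  have hmaps : ∀ z ∈ t, f z ∈ (Finset.Icc (-K) K) ×ˢ (Finset.Icc (-K) K) := by
    intro z hz
    have hre : |z.re| ≤ r := le_trans (Complex.abs_re_le_norm z) (hbd z hz)
    have him : |z.im| ≤ r := le_trans (Complex.abs_im_le_norm z) (hbd z hz)
    have hrs : r / s ≤ ⌈r / s⌉ := Int.le_ceil _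
    have key : ∀ a : ℝ, |a| ≤ r → -K ≤ ⌊a / s⌋ ∧ ⌊a / s⌋ ≤ K := by
      intro a ha
      have ha' : -r ≤ a ∧ a ≤ r := abs_le.1 ha
      have h1 : -(r / s) ≤ a / s := by
        rw [← neg_div]
        exact div_le_div_of_nonneg_right ha'.1 hs.le
      have h2 : a / s ≤ r / s := div_le_div_of_nonneg_right ha'.2 hs.le
      constructor
      · have : (-K : ℝ) ≤ a / s := by
          rw [hK]
          push_cast
          linarith
        have h3 := Int.lt_floor_add_one (a / s)
        have : (-K : ℝ) < ⌊a / s⌋ + 1 := lt_of_le_of_lt this h3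
        have : -K < ⌊a / s⌋ + 1 := by exact_mod_cast this
        omega
      · have h3 : (⌊a / s⌋ : ℝ) ≤ a / s := Int.floor_le _
        have : (⌊a / s⌋ : ℝ) ≤ K := by
          rw [hK]
          push_cast
          linarith
        exact_mod_cast this
    simp only [Finset.mem_product, Finset.mem_Icc, f]
    exact ⟨key z.re hre, key z.im him⟩
  have hinj : Set.InjOn f t := by
    intro z hz z' hz' hf
    by_contra hne
    have h1 := hsep z hz z' hz' hne
    simp only [f, Prod.mk.injEq] at hf
    have hre := abs_sub_lt_of_floor_eq hs hf.1
    have him := abs_sub_lt_of_floor_eq hs hf.2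
    have h2 : ‖z - z'‖ ≤ |(z - z').re| + |(z - z').im| := Complex.norm_le_abs_re_add_abs_im _
    simp only [Complex.sub_re, Complex.sub_im] at h2
    linarith
  have hcard := Finset.card_le_card_of_injOn f hmaps hinj
  rw [Finset.card_product, Int.card_Icc] at hcard
  have hK0 : 0 ≤ K := by
    have : (0 : ℝ) ≤ r / s := by positivity
    have h1 : (0 : ℝ) ≤ ⌈r / s⌉ := le_trans this (Int.le_ceil _)
    have h2 : (0 : ℤ) ≤ ⌈r / s⌉ := by exact_mod_cast h1
    omega
  have hKr : (K : ℝ) ≤ r / s + 2 := by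
    rw [hK]
    push_cast
    have := Int.ceil_lt_add_one (r / s)
    linarith
  have hcount : ((K + 1 - -K).toNat : ℝ) = 2 * K + 1 := by
    have h : (((K + 1 - -K).toNat : ℤ) : ℝ) = ((K + 1 - -K : ℤ) : ℝ) := by
      rw [Int.toNat_of_nonneg (by omega)]
    push_cast at h ⊢
    linarith
  calc (t.card : ℝ) ≤ (((K + 1 - -K).toNat * (K + 1 - -K).toNat : ℕ) : ℝ) := by exact_mod_cast hcard
    _ = (2 * K + 1) * (2 * K + 1) := by push_cast; rw [hcount]
    _ = (2 * K + 1) ^ 2 := by ring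
    _ ≤ (2 * (r / s) + 5) ^ 2 := by
        have h0 : (0 : ℝ) ≤ 2 * K + 1 := by positivity
        have h1 : (2 * K + 1 : ℝ) ≤ 2 * (r / s) + 5 := by linarith
        exact pow_le_pow_left₀ h0 h1 2

/-! ## B. Lattice points of the slab are separated at `w₀` -/

variable (k : Type) [Field k] [NumberField k]

/-- **SEPARATION AT `w₀`**: two distinct algebraic integers whose coordinates at the places `w ≠ w₀` are `≤ B` are at
distance `≥ ρ` at `w₀`, for a `ρ > 0` depending on `k, w₀, B` only (the product formula on their difference). -/
theorem exists_sep (w₀ : InfinitePlace k) (B : ℝ) : ∃ ρ : ℝ, 0 < ρ ∧ ∀ x y : 𝓞 k, x ≠ y →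
    (∀ w : InfinitePlace k, w ≠ w₀ → w (x : k) ≤ B) → (∀ w : InfinitePlace k, w ≠ w₀ → w (y : k) ≤ B) →
    ρ ≤ w₀ ((x : k) - (y : k)) := by
  set M : ℝ := ∏ w ∈ (Finset.univ : Finset (InfinitePlace k)).erase w₀, (max 1 (2 * B)) ^ mult w with hM
  have hM1 : 1 ≤ M := by
    rw [hM]
    exact Finset.one_le_prod fun w _ => one_le_pow₀ (le_max_left _ _)
  have hM0 : 0 < M := by linarith
  refine ⟨min 1 (1 / M), lt_min one_pos (by positivity), fun x y hxy hx hy => ?_⟩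
  set z : k := (x : k) - (y : k) with hz
  have hz0 : z ≠ 0 := by
    intro h
    apply hxy
    apply RingOfIntegers.coe_injective
    rw [RingOfIntegers.coe_eq_algebraMap, RingOfIntegers.coe_eq_algebraMap] at hz
    exact sub_eq_zero.1 h
  have hzint : IsIntegral ℤ z := by
    rw [hz]
    exact (RingOfIntegers.isIntegral_coe x).sub (RingOfIntegers.isIntegral_coe y)
  have hN : 1 ≤ ∏ w : InfinitePlace k, w z ^ mult w := by
    rw [prod_eq_abs_norm]
    exact_mod_cast Line3.one_le_abs_norm hzint hz0
  rw [← Finset.mul_prod_erase Finset.univ _ (Finset.mem_univ w₀)] at hN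
  have hrest : ∏ w ∈ (Finset.univ : Finset (InfinitePlace k)).erase w₀, w z ^ mult w ≤ M := by
    rw [hM]
    refine Finset.prod_le_prod (fun w _ => by positivity) fun w hw => ?_
    have hw' : w ≠ w₀ := (Finset.mem_erase.1 hw).1
    refine pow_le_pow_left₀ (by positivity) ?_ _
    calc w z = w ((x : k) - (y : k)) := rfl
      _ ≤ w (x : k) + w (y : k) := by
          have := w.1.sub_le (x : k) 0 (y : k)
          rw [sub_zero, zero_sub, w.1.map_neg] at this
          exact this
      _ ≤ 2 * B := by linarith [hx w hw', hy w hw']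
      _ ≤ max 1 (2 * B) := le_max_right _ _
  have hw0z : 0 ≤ w₀ z := apply_nonneg _ _
  have hkey : 1 / M ≤ w₀ z ^ mult w₀ := by
    have hpos : 0 ≤ w₀ z ^ mult w₀ := by positivity
    rw [div_le_iff₀ hM0]
    calc 1 ≤ w₀ z ^ mult w₀ * ∏ w ∈ Finset.univ.erase w₀, w z ^ mult w := hN
      _ ≤ w₀ z ^ mult w₀ * M := mul_le_mul_of_nonneg_left hrest hpos
  by_cases h1 : 1 ≤ w₀ z
  · exact le_trans (min_le_left _ _) h1
  · push Not at h1
    have h2 : w₀ z ^ mult w₀ ≤ w₀ z := pow_le_of_le_one hw0z h1.le mult_pos.ne'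
    exact le_trans (min_le_right _ _) (le_trans hkey h2)

/-! ## C. The count -/

/-- **THE SLAB COUNT**: for a number field `k`, a place `w₀` and a bound `B` there is `C′ ≥ 0` such that, for every
`R ≥ 0`, the algebraic integers `x` with `(w₀ x)² ≤ R` and `w x ≤ B` at every place `w ≠ w₀` form a finite set of at most
`C′ (1 + R)` elements. -/
theorem exists_card_le_slab (w₀ : InfinitePlace k) (B : ℝ) :
    ∃ C' : ℝ, 0 ≤ C' ∧ ∀ R : ℝ, 0 ≤ R → ∃ s : Finset (𝓞 k),
      (∀ x : 𝓞 k, (w₀ (x : k)) ^ 2 ≤ R → (∀ w : InfinitePlace k, w ≠ w₀ → w (x : k) ≤ B) → x ∈ s) ∧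
      (s.card : ℝ) ≤ C' * (1 + R) := by
  obtain ⟨ρ, hρ, hsep⟩ := exists_sep k w₀ B
  set s₀ : ℝ := ρ / 2 with hs₀
  have hs₀0 : 0 < s₀ := by positivity
  refine ⟨8 / s₀ ^ 2 + 50, by positivity, fun R hR => ?_⟩
  -- the slab is finite
  set S : Set (𝓞 k) := {x | (w₀ (x : k)) ^ 2 ≤ R ∧ ∀ w : InfinitePlace k, w ≠ w₀ → w (x : k) ≤ B} with hS
  have hfin : S.Finite := by
    have hbig := Embeddings.finite_of_norm_le k ℂ (max (Real.sqrt R) B)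
    refine (hbig.preimage (RingOfIntegers.coe_injective.injOn)).subset ?_
    intro x hx
    obtain ⟨hx1, hx2⟩ := hx
    refine ⟨RingOfIntegers.isIntegral_coe x, fun φ => ?_⟩
    rw [← InfinitePlace.apply]
    by_cases hφ : InfinitePlace.mk φ = w₀
    · rw [hφ]
      refine le_trans ?_ (le_max_left _ _)
      rw [Real.le_sqrt (apply_nonneg _ _) hR]
      exact hx1
    · exact le_trans (hx2 _ hφ) (le_max_right _ _)
  refine ⟨hfin.toFinset, fun x hx1 hx2 => hfin.mem_toFinset.2 ⟨hx1, hx2⟩, ?_⟩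
  -- the `w₀`-coordinates
  let e : 𝓞 k → ℂ := fun x => w₀.embedding (x : k)
  have hinj : Function.Injective e := fun x y h =>
    RingOfIntegers.coe_injective (w₀.embedding.injective h)
  have hcard : hfin.toFinset.card = (hfin.toFinset.image e).card :=
    (Finset.card_image_of_injective _ hinj).symm
  have hsep' : ∀ z ∈ hfin.toFinset.image e, ∀ z' ∈ hfin.toFinset.image e, z ≠ z' → 2 * s₀ ≤ ‖z - z'‖ := by
    intro z hz z' hz' hne
    obtain ⟨x, hx, rfl⟩ := Finset.mem_image.1 hz
    obtain ⟨y, hy, rfl⟩ := Finset.mem_image.1 hz'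
    have hxy : x ≠ y := fun h => hne (by rw [h])
    have hx' := hfin.mem_toFinset.1 hx
    have hy' := hfin.mem_toFinset.1 hy
    have := hsep x y hxy hx'.2 hy'.2
    rw [hs₀, mul_div_cancel₀ _ two_ne_zero]
    calc ρ ≤ w₀ ((x : k) - (y : k)) := this
      _ = ‖w₀.embedding ((x : k) - (y : k))‖ := (norm_embedding_eq _ _).symm
      _ = ‖e x - e y‖ := by rw [map_sub]
  have hbd : ∀ z ∈ hfin.toFinset.image e, ‖z‖ ≤ Real.sqrt R := by
    intro z hz
    obtain ⟨x, hx, rfl⟩ := Finset.mem_image.1 hz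
    have hx' := hfin.mem_toFinset.1 hx
    show ‖w₀.embedding (x : k)‖ ≤ Real.sqrt R
    rw [norm_embedding_eq, Real.le_sqrt (apply_nonneg _ _) hR]
    exact hx'.1
  have hgrid := card_le_of_separated hs₀0 (Real.sqrt_nonneg R) _ hsep' hbd
  rw [hcard]
  refine le_trans hgrid ?_
  -- `(2 √R / s₀ + 5)² ≤ 8 R / s₀² + 50 ≤ (8 / s₀² + 50) (1 + R)`
  have hsq : Real.sqrt R ^ 2 = R := Real.sq_sqrt hR
  have h1 : (2 * (Real.sqrt R / s₀) + 5) ^ 2 ≤ 2 * (2 * (Real.sqrt R / s₀)) ^ 2 + 2 * 5 ^ 2 := by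
    nlinarith [sq_nonneg (2 * (Real.sqrt R / s₀) - 5)]
  have h2 : (2 * (Real.sqrt R / s₀)) ^ 2 = 4 * R / s₀ ^ 2 := by
    rw [mul_pow, div_pow, hsq]
    ring
  rw [h2] at h1
  have h3 : 0 ≤ R / s₀ ^ 2 := by positivity
  calc (2 * (Real.sqrt R / s₀) + 5) ^ 2 ≤ 2 * (4 * R / s₀ ^ 2) + 2 * 5 ^ 2 := h1
    _ = 8 * (R / s₀ ^ 2) + 50 := by ring
    _ ≤ (8 / s₀ ^ 2 + 50) * (1 + R) := by
        have h4 : 0 ≤ 8 / s₀ ^ 2 := by positivity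
        have h5 : (8 / s₀ ^ 2 + 50) * (1 + R) = 8 * (R / s₀ ^ 2) + 50 + (8 / s₀ ^ 2 + 50 * R) := by ring
        rw [h5]
        linarith

end Summit.Ventures.HodgeRepro.Tier4.Line4

end
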